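import Literature.MathematicalPhysics.QuantumFieldTheory.Balaban1983to89.B9Eq344CovariantHessianRowTower
import Literature.MathematicalPhysics.QuantumFieldTheory.Balaban1983to89.B9Eq325GreenPrimeOnProjRange
import Literature.MathematicalPhysics.QuantumFieldTheory.Balaban1983to89.B9Eq3152GtildeThirdWordTwoSided

/-!
# `Balaban1983to89.B9Eq3152ThirdWordGradRowOfHessianRows` — T. Bałaban, *Propagators for lattice gauge theories in a background field*, Commun. Math. Phys. **99** (1985)
# 389–434 [Balaban1985BackgroundPropagators] (3.152)–(3.153) p. 426 (the third word of `𝔊̃_k`, Thm 3.13) with Thm 3.1 (3.43)–(3.44) p. 398, and [B11] T. Bałaban, *The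
# variational problem and background fields in renormalization group method for lattice gauge theories*, Commun. Math. Phys. **102** (1985) 277–309 (117) p. 296: **THE JUNCTION
# OF THIS LINEAGE'S ROUTE TO STOREY H — `H3` (the local slice-gradient row of the third word `G̃_kD_UR_kD*_UG̃_k`, G-3's ONE displayed letter) FOLLOWS FROM THE CLOSED COVARIANT
# HESSIAN ROW (`B9Eq344CovariantHessianRowTower`) AND FOUR FIRST-ORDER ROWS of `ω = R_kG′_kD*_Uf`, `u = G′_kω` (value and η-scale `½`-Hölder rows of `ω`; value row of `u`;
# covariant-gradient row of `u` — all with block decay from the support block of `f`).**  By G-1 (`B9Eq3152GtildeThirdWordTwoSided.thirdWord_G1LatticeKPi_eq`) the word is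
# `D_Uu`; by `B9Eq325GreenPrimeOnProjRange.covLaplaceSiteK_GpOfUk_RofUk` `Δ^η_Uu = ω` EXACTLY; the four rows, converted from block decay to the `cosh` weight centred at the
# output bond (`exp_bigBlockDist_le_weight_site`, rate `a` with `aL^{n+1} ≥ min(√(1∕(4d+1)), κH∕d)`), feed `exists_hessRow_of_laplace_eq`; NO Hessian letter of a site
# propagator on arbitrary data is displayed (that letter — the previous junction's (HLb) — is unsatisfiable uniformly in the height, see this lineage's gen-95 memo).
# The four rows are gen 93∕94's CLOSED letters ((HLa) with `ε = ½`: `B9Eq343GreenPrimeDstarHolderRowTowerOfFlatWindow` + `B9Eq343LocalHolderFlat` + HJ-3; the value and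
# gradient rows of `G′_k` on decaying sup data: (DRC)∕(GRC) on block pieces) — their bundling into (HR) is the successor's docking step.  NE9 crux-team LEAF PROVER 01, gen 95.

statement-level skeleton of published theorems with citation tags; proofs where landed; nothing here is a claim about the Yang–Mills mass gap

CITATION HEADER (lean-in-tree rule).  Audit cell `pub-balaban`, sub-cell `t4`, BINDER row NE9; filed by NE9 crux-team LEAF PROVER 01 (`b2b-balaban-t4-ne9-formalise-leaf-01`,
gen 95; bears_on: R4/N22).  Source READ first-hand (`paper:balaban1985-cmp99-background-propagators`, pp. 394–398, 419, 426; `paper:balaban1985-cmp102-variational`, p. 296).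
REUSED BY NAME: `B9Eq344CovariantHessianRowTower.exists_hessRow_of_laplace_eq`, `B9Eq325GreenPrimeOnProjRange.covLaplaceSiteK_GpOfUk_RofUk`, `B9Eq3152GtildeThirdWordTwoSided.
thirdWord_G1LatticeKPi_eq`, `B9Eq342GreenPrimeTowerSupBoundDecayCosh.exp_bigBlockDist_le_weight_site`, `B9Eq342CoshWeightSite.weight_site_centre`, `B9Eq342GreenPrimeSupBoundDecayCosh.
rate_explicit`, `B9Eq342CovariantResolventAdjointRowLetters.rePos_covLaplaceSiteK_add`, `B9Eq310HessianHermitian.adTransportW_adjoint`, `B9Eq3117Current.plaqU_swap`,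
`B9Eq3117ConjugationDefects.plaqU_self`; the binder block of `H3` is HJ-2's (`B9Eq3152ThirdWordPiGradRowOfHolderLetters`) verbatim.  Nothing printed is a hypothesis.

WHAT IS PROVED (sorry-free; proof lane — 0 `def`).
* §0 `norm_plaqU_sub_one_le_of_plaqHolU` — the plaquette window for ALL ordered pairs from the block's `_hpl` (`μ < ν`), by orientation reversal and `U1`; `rate_letters` (private,
  adapted from gen 93's `B9Eq343ResolventHolderRowTowerOfFlat`).
* §1 **`exists_local_gradLetter_thirdWord_of_rows`** — (HR) ⟹ `H3`: `∃ (α₃, B₃, δ₃)` before (T4E)'s binder block such that for `f` supported over `Π⁻¹(v)` with `‖f‖_∞ ≤ F`, every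
  `μ`, `b`: `‖(D_U(G̃_kD_UR_kD*_UG̃_kf)_μ)(b)‖ ≤ B₃·e^{−δ₃·d_m(Π(b₋),v)}·F`, with `B₃ = 24·ΘH·Ba`, `δ₃ = min(δa, √(1∕(4d+1)), κH∕d)`.
HONEST SCOPE.  A junction on the MODEL; (HR) is a displayed hypothesis (four first-order rows, each a composite of LANDED letters — not discharged here).  Nothing of print's Thm 3.1 ∕
3.13 or [B11] (117) on print's objects is asserted; «NE9 ⇐ the named binders»; NE9 NOT PRINTED ∕ NOT PROVED; row WALLED ON A MODEL (O-NE9-1; #5 UNRULED); spine PROVED 0∕9; rung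
(B)+1 on a finite T⁴ — NOT infinite volume, NOT mass gap, NOT BetaPertH, NOT Clay.  NEW file; nothing modified.  Net new unproved facts: 0.
-/

noncomputable section

open scoped InnerProductSpace ComplexConjugate BigOperators

namespace Literature.MathematicalPhysics.QuantumFieldTheory.Balaban1983to89.B9Eq3152ThirdWordGradRowOfHessianRows

open B4Sect5Torus (TSite tdist tdist_nonneg tdist_triangle)
open B4TorusKernel.MultiPeriod (circAbs)
open B9SectCLatticeCarrier (Bond bpos shift unshift)
open B9Eq311L2Pairing (WL2)
open B9Eq319QprimeTorus (fineP blockCoord)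
open B7Prop1Explicit (U1 Wcx boxVec mem_U1 norm_inv_sub_one_le)
open B11Eq103H1Complex (SiteL2K BondL2K covDerivL2K covDivL2K covLaplaceSiteK G1LatticeK)
open B9Eq310DeltaPrime (plaqHolU)
open B9Eq310HessianOperator (adTransportW)
open B9Eq310HessianHermitian (adTransportW_adjoint)
open B9Eq315QTorus (perCfg cornerSite)
open B9Eq315QTower (towerP towerP_apply UlevOf)
open B9Eq316TowerFlatIsOneStep (towerP_eq_fineP_pow siteCast)
open B9Eq326OperatorTower (RofUk laplaceAk)
open B9Eq324DeltaPrimeATower (laplacePrimeAk GpOfUk)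
open B9Eq3119DeltaPiTower (laplaceAkPi)
open B9Eq33CovDerivVector (shiftEquiv)
open B9Eq39Adjoint (plaqU J)
open B9Eq3117Current (plaqU_swap)
open B9Eq3117ConjugationDefects (plaqU_self)
open B9Eq342CoshWeightSite (weight_site_centre)
open B9Eq342GreenPrimeSupBoundDecayCosh (rate_explicit)
open B9Eq342GreenPrimeTowerSupBoundDecayCosh (exp_bigBlockDist_le_weight_site)
open B9Eq342CovariantResolventAdjointRowLetters (rePos_covLaplaceSiteK_add)
open B9Eq325GreenPrimeOnProjRange (covLaplaceSiteK_GpOfUk_RofUk)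
open B9Eq3152GtildeThirdWordTwoSided (thirdWord_G1LatticeKPi_eq)
open B9Eq344CovariantHessianRowTower (exists_hessRow_of_laplace_eq)

/-! ## §0 The plaquette window for all ordered pairs; the rate -/

section Plaq

variable {d : ℕ} {Pd : Fin d → ℕ} {𝔸 : Type*} [NormedRing 𝔸] [NormedAlgebra ℂ 𝔸] [NormOneClass 𝔸]

omit [NormedAlgebra ℂ 𝔸] in
/-- **`‖U(∂p_{κν}(x)) − 1‖ ≤ ε` FOR ALL `κ, ν`** from the positively oriented plaquettes (`κ < ν`, `B9Eq310DeltaPrime.plaqHolU`): `κ = ν` is the unit, `ν < κ` the inverse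
(`plaqU_swap`, `‖P⁻¹ − 1‖ ≤ ‖P − 1‖` on `U1`). [folklore] [cite: Balaban1985BackgroundPropagators, (3.5) p.391, (3.35) p.396] -/
theorem norm_plaqU_sub_one_le_of_plaqHolU (U : Bond d Pd → 𝔸ˣ) (hUb : ∀ b, U b ∈ U1 𝔸) {ε : ℝ} (hε : 0 ≤ ε)
    (hpl : ∀ p : B9SectCLatticeCarrier.Plaq d Pd, ‖(plaqHolU U p : 𝔸) - 1‖ ≤ ε) (κ ν : Fin d) (x : TSite d Pd) :
    ‖((plaqU (fun μ => shiftEquiv (Pd := Pd) μ) (fun μ y => U (y, μ)) κ ν x : 𝔸ˣ) : 𝔸) - 1‖ ≤ ε := by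
  have key : ∀ (κ ν : Fin d) (h : κ < ν), plaqU (fun μ => shiftEquiv (Pd := Pd) μ) (fun μ y => U (y, μ)) κ ν x = plaqHolU U (x, ⟨(κ, ν), h⟩) :=
    fun κ ν _ => rfl
  rcases lt_trichotomy κ ν with h | h | h
  · rw [key κ ν h]; exact hpl _
  · subst h; rw [plaqU_self, Units.val_one, sub_self, norm_zero]; exact hε
  · have hmem : plaqU (fun μ => shiftEquiv (Pd := Pd) μ) (fun μ y => U (y, μ)) ν κ x ∈ U1 𝔸 :=
      (U1 𝔸).mul_mem ((U1 𝔸).mul_mem ((U1 𝔸).mul_mem (hUb _) (hUb _)) ((U1 𝔸).inv_mem (hUb _))) ((U1 𝔸).inv_mem (hUb _))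
    rw [plaqU_swap]
    exact (norm_inv_sub_one_le hmem).trans (by rw [key ν κ h]; exact hpl _)

end Plaq

/-- the rate `a = min(a⋆, κ∕(dK))`: window, `aK ≤ 1`, `adK ≤ κ`, and the uniform lower bound `aK ≥ min(√(1∕(4d+1)), κ∕d)`.
-- adapted from gen 93's private `B9Eq343ResolventHolderRowTowerOfFlat.rate_letters` [folklore] -/
private theorem rate_letters {d t as κ : ℝ} (hd1 : 1 ≤ d) (ht : 0 < t) (has0 : 0 < as) (has1 : as ≤ 1) (hκ : 0 < κ)
    (hlams : 1 / 2 ≤ 1 - 2 * d * t ^ 2 * (Real.cosh as - 1)) (hasq : as ^ 2 = 1 / (4 * d * t ^ 2 + 1)) (haKs : Real.sqrt (1 / (4 * d + 1)) ≤ as * t) :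
    ∃ a : ℝ, 0 ≤ a ∧ a ≤ 1 ∧ a * t ≤ 1 ∧ 1 / 2 ≤ 1 - 2 * d * t ^ 2 * (Real.cosh a - 1) ∧ a * d * t ≤ κ ∧
      min (Real.sqrt (1 / (4 * d + 1))) (κ / d) ≤ a * t := by
  have hd0 : 0 < d := by linarith
  have ha0 : 0 ≤ min as (κ / (d * t)) := le_min has0.le (by positivity)
  have haas : min as (κ / (d * t)) ≤ as := min_le_left _ _
  have hats : as * t ≤ 1 := by
    have h2 : (as * t) ^ 2 ≤ 1 := by
      rw [mul_pow, hasq, div_mul_eq_mul_div, one_mul, div_le_one (by positivity)]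
      nlinarith [sq_nonneg t, mul_le_mul_of_nonneg_right hd1 (sq_nonneg t)]
    nlinarith [mul_nonneg has0.le ht.le]
  have hcosh : Real.cosh (min as (κ / (d * t))) ≤ Real.cosh as := by
    rw [Real.cosh_le_cosh, abs_of_nonneg ha0, abs_of_nonneg has0.le]; exact haas
  refine ⟨min as (κ / (d * t)), ha0, haas.trans has1, (mul_le_mul_of_nonneg_right haas ht.le).trans hats, ?_, ?_, ?_⟩
  · nlinarith [mul_nonneg (mul_nonneg (by norm_num : (0:ℝ) ≤ 2) hd0.le) (sq_nonneg t)]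
  · calc min as (κ / (d * t)) * d * t ≤ (κ / (d * t)) * d * t := by gcongr; exact min_le_right _ _
      _ = κ := by field_simp
  · rw [min_mul_of_nonneg _ _ ht.le]
    exact min_le_min haKs (le_of_eq (by field_simp))

/-! ## §1 `H3` from the Hessian row and the four first-order rows -/

variable {d : ℕ} (L : ℕ) [NeZero L] (hL : 1 ≤ L) (hL3 : 3 ≤ L)
  {𝔸 : Type*} [NormedRing 𝔸] [NormedAlgebra ℂ 𝔸] [CompleteSpace 𝔸] [NormOneClass 𝔸] [StarRing 𝔸] [StarModule ℂ 𝔸]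
  {W : Type*} [NormedAddCommGroup W] [InnerProductSpace ℂ W] [FiniteDimensional ℂ W] (φ : W ≃ₗ[ℂ] 𝔸)
  {a : ℝ} {a' Mφ Mφ' : ℝ} (hMφ : 0 ≤ Mφ) (hMφ' : 0 ≤ Mφ') (hφ : ∀ w, ‖φ w‖ ≤ Mφ * ‖w‖) (hφ' : ∀ X, ‖φ.symm X‖ ≤ Mφ' * ‖X‖) (ha' : 0 < a')
  {ϱ : ℝ} (hϱ0 : 0 ≤ ϱ) (hϱ1 : ϱ < 1)
  (τ : 𝔸 →ₗ[ℂ] ℂ) {ρw : ℝ}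
  (hτ₁ : ∀ X : 𝔸, τ (star X) = conj (τ X)) (hτ₂ : ∀ X Y : 𝔸, τ (X * Y) = τ (Y * X)) (hφτ : ∀ X Y : 𝔸, ⟪φ.symm X, φ.symm Y⟫_ℂ = τ (star X * Y))
  (AQ : ℝ)

include hL3 hMφ hMφ' hφ hφ' ha' hϱ0 hϱ1 hτ₁ hτ₂ hφτ in
/-- **`H3` FROM THE COVARIANT HESSIAN ROW AND FOUR FIRST-ORDER ROWS.**  If (HR): with block decay from the support block `v` of `f` (`‖f‖_∞ ≤ F`), the site function
`ω = R_kG′_kD*_Uf` has the value row and the η-scale `½`-Hölder row, and `u = G′_kω` has the value row and the covariant-gradient row (common constants `αa, Ba, δa`), then the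
third word's local slice-gradient row `H3` holds: `‖(D_U(G̃_kD_UR_kD*_UG̃_kf)_μ)(b)‖ ≤ 24ΘH·Ba·e^{−δ₃·d_m(Π(b₋),v)}·F`.  Mechanism: G-1 (`= D_Uu`), `Δ^η_Uu = ω` (3.22)+(3.25), the
closed Hessian row `exists_hessRow_of_laplace_eq` at centre `b₋` with the rows converted to the `cosh` weight (`e^{−δa d(Πy,v)} ≤ 6e^{−δ₃d(Πb₋,v)}W_{b₋}(y)`, `δ₃ ≤ δa`, `δ₃ ≤ aL^{n+1}`).
[cite: Balaban1985BackgroundPropagators, (3.152)–(3.153) p.426, Thm 3.1 (3.43)–(3.44) p.398, (3.22)–(3.25) p.394, (3.36) p.396] [cite: Balaban1985Variational, (117) p.296] -/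
theorem exists_local_gradLetter_thirdWord_of_rows (hd : 1 ≤ d)
    (HR : ∃ αa Ba δa : ℝ, 0 < αa ∧ 0 ≤ Ba ∧ 0 < δa ∧
      ∀ (n : ℕ) (η : ℝ) (_hηL : η * (L : ℝ) ^ (n + 1) = 1) (c₀ c₁ : ℝ) [Fact (0 < c₀)] [Fact (0 < c₁)]
        (_hw : c₀ * ((L : ℝ) ^ (n + 1)) ^ d = c₁) (_hρ : |η| ^ d / c₀ ≤ ρw) (m : Fin d → ℕ) [∀ i, NeZero (m i)] (_hm : ∀ i, 1 ≤ m i)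
        (U : Bond d (towerP L m (n + 1)) → 𝔸ˣ) (αU : ℕ → ℝ) (_hα0 : ∀ j, 0 ≤ αU j) (hα1 : ∀ j, αU j ≤ 1 / 64)
        (hU1 : ∀ (j : ℕ) (x : B7Prop1Explicit.Site d) (k : Fin d), perCfg (towerP L m (j + 1)) (UlevOf L m (n + 1) U j) x k ∈ U1 𝔸)
        (hreg : ∀ (j : ℕ) (y : TSite d (towerP L m j)) (k : Fin d) (ρ' : Fin d → Fin L),
          ‖((Wcx L (perCfg (towerP L m (j + 1)) (UlevOf L m (n + 1) U j)) (cornerSite L y) k (boxVec L ρ') : 𝔸ˣ) : 𝔸) - 1‖ ≤ αU j)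
        (εU : ℕ → ℝ) (_hεU : ∀ j, 0 ≤ εU j) (_hUε : ∀ (j : ℕ) (b : Bond d (towerP L m (j + 1))), ‖(UlevOf L m (n + 1) U j b : 𝔸) - 1‖ ≤ εU j)
        (_hLb : ∀ (j : ℕ) (b : Bond d (towerP L m (j + 1))), UlevOf L m (n + 1) U j b ∈ U1 𝔸)
        (α : ℝ) (_hα : 0 ≤ α) (_hαle : α ≤ αa)
        (hUst : ∀ b, star (U b : 𝔸) = (((U b)⁻¹ : 𝔸ˣ) : 𝔸)) (_hUb : ∀ b, U b ∈ U1 𝔸) (_hUη : ∀ b, ‖(U b : 𝔸) - 1‖ ≤ α * η)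
        (_hpl : ∀ p : B9SectCLatticeCarrier.Plaq d (towerP L m (n + 1)), ‖(plaqHolU U p : 𝔸) - 1‖ ≤ α * η ^ 2)
        (_hUgrad : ∀ (x : TSite d (towerP L m (n + 1))) (μ : Fin d), ‖(U (x, μ) : 𝔸) - U (unshift μ x, μ)‖ ≤ α * η ^ 2)
        (_hRlev : ∀ (j : ℕ) (b : Bond d (towerP L m (j + 1))) (w : W), ‖adTransportW φ (UlevOf L m (n + 1) U j) b w‖ ≤ ‖w‖)
        (_hεg : ∀ j < n + 1, εU j ≤ α * ϱ ^ j) (_hAQ : ∑ j ∈ Finset.range (n + 1), αU j ≤ AQ)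
        (hpos' : ∀ x : SiteL2K ℂ d (towerP L m (n + 1)) c₀ W, x ≠ 0 → 0 < RCLike.re ⟪x, laplacePrimeAk L m n φ η U a' (c₁ := c₁) x⟫_ℂ)
        (hpos : ∀ x : BondL2K ℂ d (towerP L m (n + 1)) c₀ W, x ≠ 0 →
          0 < RCLike.re ⟪x, laplaceAk L m n φ η U hL αU hα1 hU1 hreg τ (c₀ := c₀) (c₁ := c₁) a x⟫_ℂ)
        (hposπ : ∀ x : BondL2K ℂ d (towerP L m (n + 1)) c₀ W, x ≠ 0 →
          0 < RCLike.re ⟪x, laplaceAkPi L m n φ τ η U a' hpos' hL αU hα1 hU1 hreg (c₁ := c₁) a x⟫_ℂ)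
        (_hc₀ : c₀ = η ^ d)
        (_hJ : ∀ (μ : Fin d) (y : TSite d (towerP L m (n + 1))),
          ‖B9Eq39Adjoint.J (fun μ => B9Eq33CovDerivVector.shiftEquiv μ) (fun μ y => U (y, μ)) η μ y‖ ≤ α)
        (v : TSite d m) (f : BondL2K ℂ d (towerP L m (n + 1)) c₀ W) (F : ℝ)
        (_hfv : ∀ b, blockCoord (L ^ (n + 1)) m (siteCast (towerP_eq_fineP_pow L m (n + 1)) (bpos b)) ≠ v →
          WL2.equiv ℂ (fun _ : Bond d (towerP L m (n + 1)) => c₀) W f b = 0)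
        (_hfF : ∀ b, ‖WL2.equiv ℂ (fun _ : Bond d (towerP L m (n + 1)) => c₀) W f b‖ ≤ F),
        (∀ x : TSite d (towerP L m (n + 1)), ‖WL2.equiv ℂ (fun _ : TSite d (towerP L m (n + 1)) => c₀) W (RofUk L m n φ η U (GpOfUk L m n φ η U a' (c₁ := c₁) hpos' (covDivL2K ℂ c₀ ((η : ℂ))⁻¹ (adTransportW φ fun bb => (U bb)⁻¹) f))) x‖ ≤ Ba * Real.exp (-(δa * tdist m (blockCoord (L ^ (n + 1)) m (siteCast (towerP_eq_fineP_pow L m (n + 1)) x)) v)) * F) ∧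
        (∀ x x' : TSite d (towerP L m (n + 1)), tdist (towerP L m (n + 1)) x x' ≤ (L : ℝ) ^ (n + 1) →
          ‖WL2.equiv ℂ (fun _ : TSite d (towerP L m (n + 1)) => c₀) W (RofUk L m n φ η U (GpOfUk L m n φ η U a' (c₁ := c₁) hpos' (covDivL2K ℂ c₀ ((η : ℂ))⁻¹ (adTransportW φ fun bb => (U bb)⁻¹) f))) x' - WL2.equiv ℂ (fun _ : TSite d (towerP L m (n + 1)) => c₀) W (RofUk L m n φ η U (GpOfUk L m n φ η U a' (c₁ := c₁) hpos' (covDivL2K ℂ c₀ ((η : ℂ))⁻¹ (adTransportW φ fun bb => (U bb)⁻¹) f))) x‖ ≤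
            Ba * Real.exp (-(δa * tdist m (blockCoord (L ^ (n + 1)) m (siteCast (towerP_eq_fineP_pow L m (n + 1)) x)) v)) * (tdist (towerP L m (n + 1)) x x' / (L : ℝ) ^ (n + 1)) ^ ((1 : ℝ) / 2) * F) ∧
        (∀ x : TSite d (towerP L m (n + 1)), ‖WL2.equiv ℂ (fun _ : TSite d (towerP L m (n + 1)) => c₀) W (GpOfUk L m n φ η U a' (c₁ := c₁) hpos' (RofUk L m n φ η U (GpOfUk L m n φ η U a' (c₁ := c₁) hpos' (covDivL2K ℂ c₀ ((η : ℂ))⁻¹ (adTransportW φ fun bb => (U bb)⁻¹) f)))) x‖ ≤ Ba * Real.exp (-(δa * tdist m (blockCoord (L ^ (n + 1)) m (siteCast (towerP_eq_fineP_pow L m (n + 1)) x)) v)) * F) ∧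
        (∀ bb : Bond d (towerP L m (n + 1)), ‖WL2.equiv ℂ (fun _ : Bond d (towerP L m (n + 1)) => c₀) W (covDerivL2K ℂ c₀ ((η : ℂ))⁻¹ (adTransportW φ U) (GpOfUk L m n φ η U a' (c₁ := c₁) hpos' (RofUk L m n φ η U (GpOfUk L m n φ η U a' (c₁ := c₁) hpos' (covDivL2K ℂ c₀ ((η : ℂ))⁻¹ (adTransportW φ fun bb => (U bb)⁻¹) f))))) bb‖ ≤
          Ba * Real.exp (-(δa * tdist m (blockCoord (L ^ (n + 1)) m (siteCast (towerP_eq_fineP_pow L m (n + 1)) (bpos bb))) v)) * F)) :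
    ∃ α₃ B₃ δ₃ : ℝ, 0 < α₃ ∧ 0 ≤ B₃ ∧ 0 < δ₃ ∧
      ∀ (n : ℕ) (η : ℝ) (_hηL : η * (L : ℝ) ^ (n + 1) = 1) (c₀ c₁ : ℝ) [Fact (0 < c₀)] [Fact (0 < c₁)]
        (_hw : c₀ * ((L : ℝ) ^ (n + 1)) ^ d = c₁) (_hρ : |η| ^ d / c₀ ≤ ρw) (m : Fin d → ℕ) [∀ i, NeZero (m i)] (_hm : ∀ i, 1 ≤ m i)
        (U : Bond d (towerP L m (n + 1)) → 𝔸ˣ) (αU : ℕ → ℝ) (_hα0 : ∀ j, 0 ≤ αU j) (hα1 : ∀ j, αU j ≤ 1 / 64)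
        (hU1 : ∀ (j : ℕ) (x : B7Prop1Explicit.Site d) (k : Fin d), perCfg (towerP L m (j + 1)) (UlevOf L m (n + 1) U j) x k ∈ U1 𝔸)
        (hreg : ∀ (j : ℕ) (y : TSite d (towerP L m j)) (k : Fin d) (ρ' : Fin d → Fin L),
          ‖((Wcx L (perCfg (towerP L m (j + 1)) (UlevOf L m (n + 1) U j)) (cornerSite L y) k (boxVec L ρ') : 𝔸ˣ) : 𝔸) - 1‖ ≤ αU j)
        (εU : ℕ → ℝ) (_hεU : ∀ j, 0 ≤ εU j) (_hUε : ∀ (j : ℕ) (b : Bond d (towerP L m (j + 1))), ‖(UlevOf L m (n + 1) U j b : 𝔸) - 1‖ ≤ εU j)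
        (_hLb : ∀ (j : ℕ) (b : Bond d (towerP L m (j + 1))), UlevOf L m (n + 1) U j b ∈ U1 𝔸)
        (α : ℝ) (_hα : 0 ≤ α) (_hαle : α ≤ α₃)
        (hUst : ∀ b, star (U b : 𝔸) = (((U b)⁻¹ : 𝔸ˣ) : 𝔸)) (_hUb : ∀ b, U b ∈ U1 𝔸) (_hUη : ∀ b, ‖(U b : 𝔸) - 1‖ ≤ α * η)
        (_hpl : ∀ p : B9SectCLatticeCarrier.Plaq d (towerP L m (n + 1)), ‖(plaqHolU U p : 𝔸) - 1‖ ≤ α * η ^ 2)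
        (_hUgrad : ∀ (x : TSite d (towerP L m (n + 1))) (μ : Fin d), ‖(U (x, μ) : 𝔸) - U (unshift μ x, μ)‖ ≤ α * η ^ 2)
        (_hRlev : ∀ (j : ℕ) (b : Bond d (towerP L m (j + 1))) (w : W), ‖adTransportW φ (UlevOf L m (n + 1) U j) b w‖ ≤ ‖w‖)
        (_hεg : ∀ j < n + 1, εU j ≤ α * ϱ ^ j) (_hAQ : ∑ j ∈ Finset.range (n + 1), αU j ≤ AQ)
        (hpos' : ∀ x : SiteL2K ℂ d (towerP L m (n + 1)) c₀ W, x ≠ 0 → 0 < RCLike.re ⟪x, laplacePrimeAk L m n φ η U a' (c₁ := c₁) x⟫_ℂ)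
        (hpos : ∀ x : BondL2K ℂ d (towerP L m (n + 1)) c₀ W, x ≠ 0 →
          0 < RCLike.re ⟪x, laplaceAk L m n φ η U hL αU hα1 hU1 hreg τ (c₀ := c₀) (c₁ := c₁) a x⟫_ℂ)
        (hposπ : ∀ x : BondL2K ℂ d (towerP L m (n + 1)) c₀ W, x ≠ 0 →
          0 < RCLike.re ⟪x, laplaceAkPi L m n φ τ η U a' hpos' hL αU hα1 hU1 hreg (c₁ := c₁) a x⟫_ℂ)
        (_hc₀ : c₀ = η ^ d)
        (_hJ : ∀ (μ : Fin d) (y : TSite d (towerP L m (n + 1))),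
          ‖B9Eq39Adjoint.J (fun μ => B9Eq33CovDerivVector.shiftEquiv μ) (fun μ y => U (y, μ)) η μ y‖ ≤ α)
        (v : TSite d m) (f : BondL2K ℂ d (towerP L m (n + 1)) c₀ W) (F : ℝ)
        (_hfv : ∀ b, blockCoord (L ^ (n + 1)) m (siteCast (towerP_eq_fineP_pow L m (n + 1)) (bpos b)) ≠ v →
          WL2.equiv ℂ (fun _ : Bond d (towerP L m (n + 1)) => c₀) W f b = 0)
        (_hfF : ∀ b, ‖WL2.equiv ℂ (fun _ : Bond d (towerP L m (n + 1)) => c₀) W f b‖ ≤ F) (μ : Fin d) (b : Bond d (towerP L m (n + 1))),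
        ‖WL2.equiv ℂ (fun _ : Bond d (towerP L m (n + 1)) => c₀) W (covDerivL2K ℂ c₀ ((η : ℂ))⁻¹ (adTransportW φ U)
            ((WL2.equiv ℂ (fun _ : TSite d (towerP L m (n + 1)) => c₀) W).symm fun y =>
              WL2.equiv ℂ (fun _ : Bond d (towerP L m (n + 1)) => c₀) W
                (G1LatticeK hposπ (covDerivL2K ℂ c₀ ((η : ℂ))⁻¹ (adTransportW φ U) (RofUk L m n φ η U
                  (covDivL2K ℂ c₀ ((η : ℂ))⁻¹ (adTransportW φ fun bb => (U bb)⁻¹) (G1LatticeK hposπ f))))) (y, μ))) b‖ ≤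
          B₃ * Real.exp (-(δ₃ * tdist m (blockCoord (L ^ (n + 1)) m (siteCast (towerP_eq_fineP_pow L m (n + 1)) (bpos b))) v)) * F := by
  classical
  obtain ⟨αa, Ba, δa, hαa, hBa, hδa, HA⟩ := HR
  obtain ⟨αH, ΘH, κH, hαH, hΘH, hκH, HH⟩ :=
    exists_hessRow_of_laplace_eq L hL3 φ (a' := a') hMφ hMφ' hφ hφ' ha' hϱ0 hϱ1 τ hτ₂ hφτ hd
  have hd1 : (1 : ℝ) ≤ d := by exact_mod_cast hd
  have hd0 : (0 : ℝ) < d := by linarith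
  set δ₃ : ℝ := min δa (min (Real.sqrt (1 / (4 * d + 1))) (κH / d)) with hδ₃
  have hδ₃0 : 0 < δ₃ := lt_min hδa (lt_min (Real.sqrt_pos.2 (by positivity)) (by positivity))
  have hδ₃a : δ₃ ≤ δa := min_le_left _ _
  refine ⟨min αa αH, 24 * ΘH * Ba, δ₃, lt_min hαa hαH, by positivity, hδ₃0, ?_⟩
  intro n η hηL c₀ c₁ _ _ hw hρ m _ hm U αU hα0 hα1 hU1 hreg εU hεU hUε hLb α hα hαle hUst hUb hUη hpl hUgrad hRlev hεg hAQ hpos' hpos hposπ hc₀ hJ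
    v f F hfv hfF μ b
  have hαa' : α ≤ αa := hαle.trans (min_le_left _ _)
  have hαH' : α ≤ αH := hαle.trans (min_le_right _ _)
  obtain ⟨hωN, hωH, huN, hwN⟩ := HA n η hηL c₀ c₁ hw hρ m hm U αU hα0 hα1 hU1 hreg εU hεU hUε hLb α hα hαa' hUst hUb hUη hpl hUgrad hRlev hεg hAQ hpos' hpos
    hposπ hc₀ hJ v f F hfv hfF
  -- the scale letters
  have hK1 : (1 : ℝ) ≤ (L : ℝ) ^ (n + 1) := one_le_pow₀ (by exact_mod_cast (by omega : 1 ≤ L))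
  have hK0 : (0 : ℝ) < (L : ℝ) ^ (n + 1) := lt_of_lt_of_le one_pos hK1
  have hη0 : 0 < η := by nlinarith only [hηL, hK0]
  have hηK : η⁻¹ = (L : ℝ) ^ (n + 1) := inv_eq_of_mul_eq_one_right hηL
  have hF0 : 0 ≤ F := (norm_nonneg _).trans (hfF ((fun _ => 0), ⟨0, by omega⟩))
  -- the rate
  obtain ⟨ha0s, ha1s, hlams, haKs⟩ := rate_explicit (d := d) η⁻¹ 1 one_pos (by rw [hηK]; exact hK1)
  have hasq : Real.sqrt (1 / (4 * d * η⁻¹ ^ 2 + 1)) ^ 2 = 1 / (4 * d * η⁻¹ ^ 2 + 1) := Real.sq_sqrt (by positivity)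
  obtain ⟨ar, har0, har1, hat, hlam, haκ', hδ'⟩ := rate_letters (κ := κH) hd1 (inv_pos.2 hη0) ha0s ha1s hκH hlams hasq haKs
  have haκ : ar * d * (L : ℝ) ^ (n + 1) ≤ κH := by rw [← hηK]; exact haκ'
  have haK1 : ar * (L : ℝ) ^ (n + 1) ≤ 1 := by rw [← hηK]; exact hat
  have hlamK : 2 * (d : ℝ) * ((L : ℝ) ^ (n + 1)) ^ 2 * (Real.cosh ar - 1) ≤ 1 / 2 := by rw [← hηK]; linarith only [hlam]
  have hδK : δ₃ ≤ ar * (L : ℝ) ^ (n + 1) := (min_le_right _ _).trans (by rw [← hηK]; exact hδ')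
  have hexp1 : Real.exp (ar * ((L : ℝ) ^ (n + 1) - 1)) ≤ 3 := by
    have h1 : ar * ((L : ℝ) ^ (n + 1) - 1) ≤ 1 := by nlinarith only [har0, haK1]
    exact (Real.exp_le_exp.2 h1).trans (by have := Real.exp_one_lt_d9; linarith only [this])
  -- positivity of `Δ^η_U + 1` and the plaquette window for all pairs
  have hRS : ∀ (bb : Bond d (towerP L m (n + 1))) (v' u' : W), ⟪adTransportW φ U bb v', u'⟫_ℂ = ⟪v', adTransportW φ (fun bb => (U bb)⁻¹) bb u'⟫_ℂ :=
    adTransportW_adjoint φ τ hτ₂ hUst hφτ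
  have hpos₁ : ∀ z : SiteL2K ℂ d (towerP L m (n + 1)) c₀ W, z ≠ 0 →
      0 < RCLike.re ⟪z, ((covLaplaceSiteK (c₀ := c₀) ((η : ℂ))⁻¹ (adTransportW φ U) (adTransportW φ fun bb => (U bb)⁻¹) + (1 : ℂ) • LinearMap.id :
        SiteL2K ℂ d (towerP L m (n + 1)) c₀ W →ₗ[ℂ] SiteL2K ℂ d (towerP L m (n + 1)) c₀ W)) z⟫_ℂ := by
    have h := rePos_covLaplaceSiteK_add (c₀ := c₀) η⁻¹ one_pos (adTransportW φ U) (adTransportW φ fun bb => (U bb)⁻¹) hRS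
    simp only [Complex.ofReal_inv, Complex.ofReal_one] at h
    exact h
  have hplU : ∀ (κ ν : Fin d) (x : TSite d (towerP L m (n + 1))),
      ‖((plaqU (fun μ => shiftEquiv (Pd := towerP L m (n + 1)) μ) (fun μ y => U (y, μ)) κ ν x : 𝔸ˣ) : 𝔸) - 1‖ ≤ α * η ^ 2 :=
    norm_plaqU_sub_one_le_of_plaqHolU U hUb (by positivity) hpl
  -- the word is `D_Uu`
  simp only [thirdWord_G1LatticeKPi_eq L m n φ τ hτ₁ hτ₂ hφτ η U hUst a' hpos' hL αU hα1 hU1 hreg a hposπ]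
  -- the conversion of block decay to the weight centred at `b₋`
  set x₀ : TSite d (towerP L m (n + 1)) := bpos b with hx₀
  set D₀ : ℝ := tdist m (blockCoord (L ^ (n + 1)) m (siteCast (towerP_eq_fineP_pow L m (n + 1)) x₀)) v with hD₀
  have hconv : ∀ y : TSite d (towerP L m (n + 1)),
      Real.exp (-(δa * tdist m (blockCoord (L ^ (n + 1)) m (siteCast (towerP_eq_fineP_pow L m (n + 1)) y)) v)) ≤
        6 * Real.exp (-(δ₃ * D₀)) * ∏ ν, Real.cosh (ar * (circAbs (towerP L m (n + 1) ν)
          ((((x₀ ν : ℕ) : ZMod (towerP L m (n + 1) ν)) - ((y ν : ℕ) : ZMod (towerP L m (n + 1) ν))).val) : ℝ)) := by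
    intro y
    set Wy : ℝ := ∏ ν, Real.cosh (ar * (circAbs (towerP L m (n + 1) ν)
          ((((x₀ ν : ℕ) : ZMod (towerP L m (n + 1) ν)) - ((y ν : ℕ) : ZMod (towerP L m (n + 1) ν))).val) : ℝ)) with hWy
    have hWy0 : 0 ≤ Wy := Finset.prod_nonneg fun _ _ => (Real.cosh_pos _).le
    set Dy : ℝ := tdist m (blockCoord (L ^ (n + 1)) m (siteCast (towerP_eq_fineP_pow L m (n + 1)) y)) v with hDy
    set Dxy : ℝ := tdist m (blockCoord (L ^ (n + 1)) m (siteCast (towerP_eq_fineP_pow L m (n + 1)) x₀))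
      (blockCoord (L ^ (n + 1)) m (siteCast (towerP_eq_fineP_pow L m (n + 1)) y)) with hDxy
    have htri : D₀ ≤ Dxy + Dy := tdist_triangle hm _ _ _
    have hDy0 : 0 ≤ Dy := tdist_nonneg m _ _
    have hDxy0 : 0 ≤ Dxy := tdist_nonneg m _ _
    have hW := exp_bigBlockDist_le_weight_site L m n har0 x₀ y
    have h1 : -(δa * Dy) ≤ -(δ₃ * D₀) + ar * (L : ℝ) ^ (n + 1) * Dxy := by
      have e1 : δ₃ * Dy ≤ δa * Dy := mul_le_mul_of_nonneg_right hδ₃a hDy0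
      have e2 : δ₃ * D₀ ≤ δ₃ * (Dxy + Dy) := mul_le_mul_of_nonneg_left htri hδ₃0.le
      have e3 : δ₃ * Dxy ≤ ar * (L : ℝ) ^ (n + 1) * Dxy := mul_le_mul_of_nonneg_right hδK hDxy0
      rw [mul_add] at e2
      linarith only [e1, e2, e3]
    calc Real.exp (-(δa * Dy)) ≤ Real.exp (-(δ₃ * D₀) + ar * (L : ℝ) ^ (n + 1) * Dxy) := Real.exp_le_exp.2 h1
      _ = Real.exp (-(δ₃ * D₀)) * Real.exp (ar * (L : ℝ) ^ (n + 1) * Dxy) := Real.exp_add _ _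
      _ ≤ Real.exp (-(δ₃ * D₀)) * (Real.exp (ar * ((L : ℝ) ^ (n + 1) - 1)) * 2 * Wy) := mul_le_mul_of_nonneg_left hW (Real.exp_pos _).le
      _ ≤ Real.exp (-(δ₃ * D₀)) * (3 * 2 * Wy) :=
          mul_le_mul_of_nonneg_left (mul_le_mul_of_nonneg_right (mul_le_mul_of_nonneg_right hexp1 (by norm_num)) hWy0) (Real.exp_pos _).le
      _ = 6 * Real.exp (-(δ₃ * D₀)) * Wy := by ring
  -- the four rows in the weighted currency
  set N : ℝ := Ba * (6 * Real.exp (-(δ₃ * D₀))) * F with hN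
  have hN0 : 0 ≤ N := by positivity
  have hrow : ∀ y : TSite d (towerP L m (n + 1)),
      Ba * Real.exp (-(δa * tdist m (blockCoord (L ^ (n + 1)) m (siteCast (towerP_eq_fineP_pow L m (n + 1)) y)) v)) * F ≤
        N * ∏ ν, Real.cosh (ar * (circAbs (towerP L m (n + 1) ν)
          ((((x₀ ν : ℕ) : ZMod (towerP L m (n + 1) ν)) - ((y ν : ℕ) : ZMod (towerP L m (n + 1) ν))).val) : ℝ)) := by
    intro y
    calc _ ≤ Ba * (6 * Real.exp (-(δ₃ * D₀)) * ∏ ν, Real.cosh (ar * (circAbs (towerP L m (n + 1) ν)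
          ((((x₀ ν : ℕ) : ZMod (towerP L m (n + 1) ν)) - ((y ν : ℕ) : ZMod (towerP L m (n + 1) ν))).val) : ℝ))) * F :=
          mul_le_mul_of_nonneg_right (mul_le_mul_of_nonneg_left (hconv y) hBa) hF0
      _ = _ := by rw [hN]; ring
  have hmain := HH n η hηL c₀ c₁ hw m U α hα hαH' hUb hUη hUgrad hplU hJ εU hεU hεg hUε hLb hUst hRlev hpos' hpos₁ ar har0 haκ haK1 hlamK x₀
    (GpOfUk L m n φ η U a' (c₁ := c₁) hpos' (RofUk L m n φ η U (GpOfUk L m n φ η U a' (c₁ := c₁) hpos'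
      (covDivL2K ℂ c₀ ((η : ℂ))⁻¹ (adTransportW φ fun bb => (U bb)⁻¹) f))))
    (RofUk L m n φ η U (GpOfUk L m n φ η U a' (c₁ := c₁) hpos' (covDivL2K ℂ c₀ ((η : ℂ))⁻¹ (adTransportW φ fun bb => (U bb)⁻¹) f)))
    N N N N hN0 hN0 hN0 hN0
    (covLaplaceSiteK_GpOfUk_RofUk L m n φ η U a' hpos' _)
    (fun y => (hωN y).trans (hrow y))
    (fun y y' hyy => (hωH y y' hyy).trans (by
      have h := mul_le_mul_of_nonneg_right (hrow y) (Real.rpow_nonneg (div_nonneg (tdist_nonneg _ y y') hK0.le) ((1 : ℝ) / 2))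
      calc _ = Ba * Real.exp (-(δa * tdist m (blockCoord (L ^ (n + 1)) m (siteCast (towerP_eq_fineP_pow L m (n + 1)) y)) v)) * F *
            (tdist (towerP L m (n + 1)) y y' / (L : ℝ) ^ (n + 1)) ^ ((1 : ℝ) / 2) := by ring
        _ ≤ _ := h))
    (fun y => (huN y).trans (hrow y))
    (fun bb => (hwN bb).trans (hrow (bpos bb))) μ b
  rw [hx₀, weight_site_centre (towerP L m (n + 1)) ar (bpos b), mul_one] at hmain
  refine hmain.trans (le_of_eq ?_)
  rw [hN]
  ring

end Literature.MathematicalPhysics.QuantumFieldTheory.Balaban1983to89.B9Eq3152ThirdWordGradRowOfHessianRows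

end
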